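import Literature.IUT.LogThetaLattice.BiCoresCompat
import Literature.IUT.LogThetaLattice.StripFrameWitness
import HarnessLib

/-!
# [IUTchIII] Thm 1.5 (iv), last display: the interface `BiCoricData.HolDeltaShellData` is INHABITED
# (non-vacuity witnesses; proof-only — no definition, instance or structure is declared)

S. Mochizuki, *Inter-universal Teichmüller theory III*, §1, Theorem 1.5 (iv), kurims manuscript (May 2020)
p. 50 [claim: Mochizuki2012, status: disputed] (IUTchIII §1 Thm 1.5 (iv), kurims p.50): "by applying the
constructions of Definition 1.1, (i), (ii), to the collections of data "`Ψ_cns(†F_≻)_0`" … one obtains a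
["holomorphic"] log-shell, together with an enveloping "`log(−)`" … which we denote by
`I_{^{n,m}F_△} ⊆ log(^{n,m}F_△)` [by means of a slight abuse of notation, since no `F`-prime-strip
"`^{n,m}F_△`" has been defined!]. Then one has natural poly-isomorphisms
`{I_{^{n,m}D^⊢_△} ⊆ log(^{n,m}D^⊢_△)} ⥲ {I_{^{n,m}F^{⊢×μ}_△} ⊆ log(^{n,m}F^{⊢×μ}_△)} ⥲ {I_{^{n,m}F_△} ⊆ log(^{n,m}F_△)}`
[cf. the poly-isomorphisms obtained in Proposition 1.2, (viii)]".

abc-iut cell, layer L6, §F v1.18p «NV-L6 WAVE» row **NV-L6/BiCoricData.HolDeltaShellData** (seat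
abc-iut-w5-d207): the INHABITATION CENSUS of the L6 interfaces (abc-iut-w5-d114,
`HOME/staging/w5/w5-d114/INHABITATION-CENSUS-L6-v3.md` §A, kernel-derived) found NO producer and NO
existence theorem for abc-iut-L6-t3's interface `BiCoricData.HolDeltaShellData` (`BiCoresCompat.lean`):
a functor `^{n,m}HT ↦ {I_{^{n,m}F_△} ⊆ log(^{n,m}F_△)}` into the category `B.Sh` of log-shell data together
with the SECOND arrow of the display above, one NONEMPTY poly-isomorphism
`{I_{^{n,m}F^{⊢×μ}_△} ⊆ …} ⥲ {I_{^{n,m}F_△} ⊆ …}` per Hodge theater.  Every theorem quantified over it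
(`HolDeltaShellData.finalDisplayAt_nonempty`, the Thm 1.5 (iv) consumers) was therefore uninstantiated in
the kernel.  This file supplies:

* `HolDeltaShellData.nonempty_degenerate` — for EVERY bi-coric datum `B : BiCoricData S` the interface is
  inhabited by the TAUTOLOGICAL datum: the holomorphic shell functor := the `×μ`-shell functor
  `B.fxmDeltaHT ⋙ B.fxmShell` itself (print's "slight abuse of notation" read literally: the two objects are
  identified along the natural poly-isomorphism) and the second arrow := the singleton `{id}`.  HONEST LABEL:
  DEGENERATE/TAUTOLOGICAL — it certifies that the typed laws impose no constraint beyond `B`, NOT that the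
  genuine holomorphic log-shell of Def 1.1 (i)(ii) applied to `Ψ_cns(†F_≻)` ([IUTchII] Cor 4.10 (i), owner
  abc-iut-L6-t2, TODO-merge in `BiCoresCompat.lean`) has been constructed;
* `HolDeltaShellData.exists_degenerate_spec` — the same with the two fields exposed as equations, so that a
  consumer can see which datum was used;
* `HolDeltaShellData.nonempty_degenerate_two` — a CLOSED instance: at the two-lattice witness
  `Witness.twoBiCoric` of `StripFrameWitness.lean` (abc-iut-L6-t3; itself a toy, single-object model) the
  interface has a term, so `∃ S B, Nonempty (HolDeltaShellData B)` holds in the kernel with no hypothesis.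

Theorems only (the witnesses are built inside the proof terms: no `def`, `instance` or `structure`, so the
file is outside the D-0067 definitions freeze).  No named fact is consumed.  HONEST FRAMING: a non-vacuity
certificate of a typed interface; nothing here asserts anything about [IUTchIII] Cor. 3.12, and no side is
taken; typed ≠ proved; "not yet witnessed at the genuine model" ≠ "vacuous".
-/

noncomputable section

namespace Literature.IUT.LogThetaLattice

open CategoryTheory Literature.IUT.HodgeTheaters

universe u

namespace BiCoricData

namespace HolDeltaShellData

variable {S : StripFrame.{u}}

/-- **`HolDeltaShellData B` is inhabited for every bi-coric datum `B`** (DEGENERATE/TAUTOLOGICAL witness):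
holomorphic-shell functor := `B.fxmDeltaHT ⋙ B.fxmShell` (the `×μ`-shell of `^{n,m}F^{⊢×μ}_△` read as the
holomorphic one along the natural poly-isomorphism — [IUTchIII] Thm 1.5 (iv), kurims p. 50: "by means of a
slight abuse of notation, since no `F`-prime-strip `^{n,m}F_△` has been defined!"), second arrow := `{id}`,
which is nonempty.  Certifies joint satisfiability of the typed fields over any `B`; the genuine datum
(Def 1.1 (i)(ii) on `Ψ_cns(†F_≻)`, abc-iut-L6-t2) is NOT constructed here.
[claim: Mochizuki2012, status: disputed] (IUTchIII §1 Thm 1.5 (iv), kurims p.50) -/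
theorem nonempty_degenerate (B : BiCoricData S) : Nonempty (HolDeltaShellData B) :=
  ⟨{ holShellDelta := B.fxmDeltaHT ⋙ B.fxmShell
     fxmToHol := fun _ => PolyIso.single (Iso.refl _)
     fxmToHol_nonempty := fun _ => ⟨Iso.refl _, PolyIso.mem_single.mpr rfl⟩ }⟩

/-- The degenerate witness with its two data fields EXPOSED: there is a `HolDeltaShellData B` whose
holomorphic-shell functor is `B.fxmDeltaHT ⋙ B.fxmShell` and whose second arrow at every Hodge theater is the
singleton `{id}` (so a consumer can tell the tautological datum from a genuine one).
[claim: Mochizuki2012, status: disputed] (IUTchIII §1 Thm 1.5 (iv), kurims p.50) -/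
theorem exists_degenerate_spec (B : BiCoricData S) :
    ∃ Δ : HolDeltaShellData B, Δ.holShellDelta = B.fxmDeltaHT ⋙ B.fxmShell ∧
      ∀ X : S.HT, HEq (Δ.fxmToHol X) (PolyIso.single (Iso.refl (B.fxmShell.obj (B.fxmDeltaHT.obj X)))) :=
  ⟨{ holShellDelta := B.fxmDeltaHT ⋙ B.fxmShell
     fxmToHol := fun _ => PolyIso.single (Iso.refl _)
     fxmToHol_nonempty := fun _ => ⟨Iso.refl _, PolyIso.mem_single.mpr rfl⟩ }, rfl, fun _ => HEq.rfl⟩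

/-- Under the degenerate witness the whole last display of Thm 1.5 (iv) (`finalDisplayAt`, first arrow the
Kummer-induced `shellKummerAt`, second arrow `{id}`) is a nonempty poly-isomorphism — i.e. the existing
consumer theorem `finalDisplayAt_nonempty` is now INSTANTIATED in the kernel for every `B`.
[claim: Mochizuki2012, status: disputed] (IUTchIII §1 Thm 1.5 (iv), kurims p.50) -/
theorem exists_finalDisplayAt_nonempty (B : BiCoricData S) :
    ∃ Δ : HolDeltaShellData B, ∀ X : S.HT, (Δ.finalDisplayAt X).Nonempty := by
  obtain ⟨Δ⟩ := nonempty_degenerate B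
  exact ⟨Δ, fun X => Δ.finalDisplayAt_nonempty X⟩

/-- **Closed instance**: at abc-iut-L6-t3's two-lattice witness frame (`Witness.twoBiCoric`,
`StripFrameWitness.lean` — a single-object toy model of the strip frame) the interface `HolDeltaShellData` has a
term; hence `HolDeltaShellData` is inhabited in the kernel with NO hypothesis at all (DEGENERATE on both counts:
toy frame, tautological shell).  [claim: Mochizuki2012, status: disputed] (IUTchIII §1 Thm 1.5 (iv), kurims p.50) -/
theorem nonempty_degenerate_two : Nonempty (HolDeltaShellData Witness.twoBiCoric) :=
  nonempty_degenerate _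

/-- The bare existential form for the census fold: some strip frame and some bi-coric datum carry a
`HolDeltaShellData`. [claim: Mochizuki2012, status: disputed] (IUTchIII §1 Thm 1.5 (iv), kurims p.50) -/
theorem exists_frame_nonempty :
    ∃ (S : StripFrame.{0}) (B : BiCoricData S), Nonempty (HolDeltaShellData B) :=
  ⟨Witness.twoFrame, Witness.twoBiCoric, nonempty_degenerate_two⟩

end HolDeltaShellData

end BiCoricData

end Literature.IUT.LogThetaLattice

end
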